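import Mathlib
import HarnessLib
import Summits.HubbardSuperconductivity.HubbardSuperconductivity.Theorems.KLProgrammeH10TwoPointLimitSymbolFrameBand
import Summits.HubbardSuperconductivity.HubbardSuperconductivity.Theorems.KLProgrammeH10TwoPointLimitSymbolAngularFactor
import Summits.HubbardSuperconductivity.HubbardSuperconductivity.Theorems.KLProgrammeH10TwoPointLimitSymbolFrameProfile
import Literature.MathematicalPhysics.QuantumLattice.HubbardSectorCovarianceBounds

/-!
# Route `KLProgramme` — engine support, route (L2) symbol layer: the CONCRETE two-multiplier symbol of the overlap kernel for the pair
# `(klAnisoFamily … n₁ ω₁, klAnisoFamily … n₂ ω₂)` on an admissible frame — it IS the sample of the continuum symbol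
# `Φ(k₀, p) = G_{n₁}(k₀² + e_K(p)²) G_{n₂}(k₀² + e_K(p)²) · Z(p)`, and that symbol satisfies the zone, cell and window hypotheses

Cell `gate-hubbard-kl`, seat p4 (C5a lead), g6; HOME/prover-p4/FRAME-L22-NOTE.md §3″ (d).  With `G_n = bgmCutoffSq e₀ (16ⁿ·)` (`…SymbolFrameProfile`),
`e_K ∘ toLp` (`…SymbolFrameBand`) and the angular factor `Z` of `…SymbolAngularFactor` (square cutoff × plateaued `ζ̃_{n₁,ω₁}ζ̃_{n₂,ω₂}`):
* **`klAniso_mul_klAniso_eq_symbol`** — for every product-torus label `q`, `F_{ω₁}(k(q))·F_{ω₂}(k(q)) = Φ(a₀ + h₀·val q₁, (2π/L)·q̃₂)`,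
  `a₀ = π(1−2M)/β`, `h₀ = 2π/β` (`sampledPoint_eq`; the plateau and the square cutoff are `1` wherever the cutoffs do not vanish);
* **`symbol_zone`** (`Φ(k₀, p) = 0` once some `|p_j| ≥ π − z`), **`symbol_cell`** (points of the square-with-margin carrying the shell `|e_K| ≤ Λ_{n₁}`
  and `Z ≠ 0` lie within `ρ = (Λ_{n₁} + s_max Dt_min (3w_{n₂}/4))/(Dt_min − 2A)` of `klFermiPoint μ K θ_{n₂,ω₂}`), **`symbol_window`**
  (`Λ < |a₀ + h₀ m|` for `m < 2`, `m ≥ 2M − 2` when `Λβ < π(2M − 3)`) — the hypotheses of `…SymbolProductSampled(Zone)`.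
Hypotheses: frame of `C²` size `A` with `2A < Dt_min`, `[μ − A − e₀, μ + A + e₀] ⊆ [a, b]`, zone margin `e₀ + A + z² < −μ`, `0 < z ≤ 1`,
Fermi region `e₀ + A − μ ≤ 3`.  Everything is proved; no definitions, no named facts. [folklore]
-/

noncomputable section

namespace Summit.HubbardSuperconductivity.HubbardSuperconductivity.Theorems.TorusFourierL2

set_option linter.dupNamespace false -- summit = problem name (single-conjunct summit), D-0017

open Set Literature.MathematicalPhysics.QuantumLattice Literature.MathematicalPhysics.QuantumLattice.BandSectorCounting
open Literature.MathematicalPhysics.QuantumLattice.FermiRG Literature.Probability.LatticeModels Literature.Analysis.SpecialFunctions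
open Summit.HubbardSuperconductivity.HubbardSuperconductivity.Theorems.DispersionFlow
open Summit.HubbardSuperconductivity.HubbardSuperconductivity.Theorems.KLRegimeSplit
open Summit.HubbardSuperconductivity.HubbardSuperconductivity.Theorems.KLProgrammeLegKernels
open Summit.HubbardSuperconductivity.HubbardSuperconductivity.Theorems.PerturbedFermiCurve
open scoped Real

section Instance

variable {L M : ℕ} [NeZero L] [NeZero M] {a b : ℝ} (B : BandBounds a b) {K : TrigPolyC4v} {A : ℝ}
  (hA : ∀ p : Momentum, ∀ j ≤ 2, ‖iteratedFDeriv ℝ j (frameShift K) p‖ ≤ A) (hADt : 2 * A < B.Dtmin)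
  {μ e₀ z β : ℝ} (he : 0 < e₀) (hz : 0 < z) (hz1 : z ≤ 1) (hgap : e₀ + A + z ^ 2 < -μ) (h3 : e₀ + A - μ ≤ 3)
  (hlo : a ≤ μ - A - e₀) (hhi : μ + A + e₀ ≤ b)
  {n₁ n₂ : ℕ} (ω₁ : Fin (sectorCount n₁)) (ω₂ : Fin (sectorCount n₂))
  {Z : (Fin 2 → ℝ) → ℝ}
  (hZ : ∀ p, Z p = gnCutoff ((π + z) ^ 2 / π ^ 2) ((π + z) ^ 2) (p 0 ^ 2) * gnCutoff ((π + z) ^ 2 / π ^ 2) ((π + z) ^ 2) (p 1 ^ 2) *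
    ((radialCutoffC (1 / 2) (momToComplex p) * sectorWeightCirc n₁ ((ω₁ : ℕ) : ℤ) (polarAngle p)) *
      (radialCutoffC (1 / 2) (momToComplex p) * sectorWeightCirc n₂ ((ω₂ : ℕ) : ℤ) (polarAngle p))))
  {Φ : ℝ × (Fin 2 → ℝ) → ℂ}
  (hΦ : ∀ k₀ p, Φ (k₀, p) = ((bgmCutoffSq e₀ ((16 : ℝ) ^ n₁ * (k₀ ^ 2 + frameLevel μ K (WithLp.toLp 2 p) ^ 2)) *
      bgmCutoffSq e₀ ((16 : ℝ) ^ n₂ * (k₀ ^ 2 + frameLevel μ K (WithLp.toLp 2 p) ^ 2)) * Z p : ℝ) : ℂ))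

/-- `Λ_n ≤ e₀` (`4ⁿ ≥ 1`). [folklore] -/
theorem klScale_le_e0 {e₀ : ℝ} (he : 0 ≤ e₀) (n : ℕ) : klScale e₀ n ≤ e₀ := by
  rw [klScale]
  exact mul_le_of_le_one_right he (inv_le_one_of_one_le₀ (one_le_pow₀ (by norm_num)))

include he in
/-- **A cutoff factor vanishes where the band exceeds `e₀`**: `|e| > e₀ ⇒ C_h⁻¹(√(k₀² + e²)) = 0` (`h = −n`). [folklore] -/
theorem gnScaleCutoff_eq_zero_of_band_gt (n : ℕ) {k₀ e : ℝ} (hek : e₀ < |e|) :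
    gnScaleCutoff 4 e₀ (-(n : ℤ)) (Real.sqrt (k₀ ^ 2 + e ^ 2)) = 0 := by
  refine gnScaleCutoff_eq_zero (by norm_num) he ?_
  rw [e0_mul_zpow_neg_eq_klScale]
  have h1 : |e| ≤ Real.sqrt (k₀ ^ 2 + e ^ 2) := by
    rw [← Real.sqrt_sq_eq_abs]; exact Real.sqrt_le_sqrt (by nlinarith)
  linarith [klScale_le_e0 he.le n]

include hA h3 he hz hΦ hZ in
/-- **The two-multiplier symbol of the overlap kernel IS the sample of the continuum symbol**: for every product-torus label `q`,
`klAnisoFamily … n₁ ω₁ (k(q)) · klAnisoFamily … n₂ ω₂ (k(q)) = Φ(π(1−2M)/β + (2π/β)·val q₁, (2π/L)·q̃₂)`.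
[cite: BenfattoGiulianiMastropietro2006, §2.5 (2.45)–(2.48)] -/
theorem klAniso_mul_klAniso_eq_symbol (q : TorusSite 1 (2 * M) × TorusSite 2 L) :
    klAnisoFamily L M β μ K e₀ n₁ ω₁ (⟨(q.1 0).val, ZMod.val_lt (q.1 0)⟩, q.2) *
        klAnisoFamily L M β μ K e₀ n₂ ω₂ (⟨(q.1 0).val, ZMod.val_lt (q.1 0)⟩, q.2) =
      Φ (π * (1 - 2 * M) / β + 2 * π / β * (((q.1 0).val : ℕ) : ℝ), fun j => 2 * π / L * (((q.2 j).valMinAbs : ℤ) : ℝ)) := by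
  have hsp := sampledPoint_eq (L := L) (M := M) β q
  rw [← hsp, hΦ]
  set k₀ : ℝ := matsubaraFreq β M (⟨(q.1 0).val, ZMod.val_lt (q.1 0)⟩ : MatsubaraIdx M) with hk₀
  set c : Fin 2 → ℝ := torusCentredMomentum L q.2 with hc
  have he_eq : nambuXiCT L μ K q.2 = frameLevel μ K (WithLp.toLp 2 c) := nambuXiCT_eq_frameLevel L μ K q.2
  have hang : momentumAngle L q.2 = polarAngle c := rfl
  set u : ℝ := k₀ ^ 2 + frameLevel μ K (WithLp.toLp 2 c) ^ 2 with hu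
  -- unfold the two multipliers
  have hF : ∀ (n : ℕ) (ω : Fin (sectorCount n)), klAnisoFamily L M β μ K e₀ n ω (⟨(q.1 0).val, ZMod.val_lt (q.1 0)⟩, q.2) =
      ((gnScaleCutoff 4 e₀ (-(n : ℤ)) (Real.sqrt u) * sectorWeightCirc n ((ω : ℕ) : ℤ) (polarAngle c) : ℝ) : ℂ) := by
    intro n ω
    rw [klAnisoFamily, bgmMultiplier, he_eq, hang]
  rw [hF n₁ ω₁, hF n₂ ω₂, ← Complex.ofReal_mul]
  congr 1
  -- the square cutoff is `1` at the sample point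
  have hcπ : ∀ j, |c j| ≤ π := abs_torusCentredMomentum_le_pi L q.2
  have hsq : ∀ j, gnCutoff ((π + z) ^ 2 / π ^ 2) ((π + z) ^ 2) (c j ^ 2) = 1 := fun j =>
    sqCutoff_eq_one hz (by rw [← sq_abs]; exact pow_le_pow_left₀ (abs_nonneg _) (hcπ j) 2)
  rw [hZ c, hsq 0, hsq 1, one_mul, one_mul]
  by_cases hR : (1 : ℝ) / 2 ≤ ‖momToComplex c‖
  · -- plateau `= 1`: the identity holds factor by factor
    rw [radialCutoffC_eq_one (by norm_num) hR, one_mul, one_mul, gnScaleCutoff_sqrt_eq_bgmCutoffSq, gnScaleCutoff_sqrt_eq_bgmCutoffSq]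
    ring
  · -- inside the Fermi region's complement both cutoffs vanish
    have hnot : ¬ (1 : ℝ) ≤ ‖momToComplex c‖ := fun h1 => hR (by linarith)
    have hbig : e₀ < |frameLevel μ K (WithLp.toLp 2 c)| := by
      by_contra hle
      exact hnot (one_le_norm_of_frameBand_le hA h3 (not_lt.1 hle))
    have h1 : gnScaleCutoff 4 e₀ (-(n₁ : ℤ)) (Real.sqrt u) = 0 := gnScaleCutoff_eq_zero_of_band_gt he n₁ hbig
    have h1' : bgmCutoffSq e₀ ((16 : ℝ) ^ n₁ * u) = 0 := by rw [← gnScaleCutoff_sqrt_eq_bgmCutoffSq]; exact h1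
    rw [h1, h1']; ring

include hA hz hz1 hgap he hΦ hZ in
/-- **Zone**: the continuum symbol vanishes as soon as some `|p_j| ≥ π − z` (the band kills the strip `π − z ≤ |p_j| ≤ π + z`, the square
cutoff the rest). [folklore] -/
theorem symbol_zone (k₀ : ℝ) (p : Fin 2 → ℝ) (hp : ∃ j, π - z ≤ |p j|) : Φ (k₀, p) = 0 := by
  obtain ⟨j, hj⟩ := hp
  rw [hΦ]
  rcases le_or_gt (π + z) |p j| with hfar | hnear
  · rw [angularFactor_zone hZ hz ⟨j, hfar⟩]; simp
  · have hband : e₀ < |frameLevel μ K (WithLp.toLp 2 p)| := frameBand_zone hA hz1 hgap hj hnear.le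
    have hu : klScale e₀ n₁ ^ 2 < k₀ ^ 2 + frameLevel μ K (WithLp.toLp 2 p) ^ 2 := by
      have h1 := klScale_le_e0 he.le n₁
      have h2 : 0 < klScale e₀ n₁ := by rw [klScale]; positivity
      have h3' : e₀ ^ 2 < frameLevel μ K (WithLp.toLp 2 p) ^ 2 := by
        have := sq_lt_sq' (by linarith [abs_nonneg (frameLevel μ K (WithLp.toLp 2 p))]) hband
        rwa [sq_abs] at this
      nlinarith [pow_le_pow_left₀ h2.le h1 2, sq_nonneg k₀]
    obtain ⟨d, -, hd1, hd2⟩ := exists_abs_derivs_bgmCutoffSq_le he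
    rw [(scaleProfile_bounds he n₁ hd1 hd2).2.2.2.2 _ hu]; simp

include B hA hADt hz hz1 hgap he hlo hhi hZ in
/-- **Cell**: a point of the square-with-margin in the shell `|e_K| ≤ Λ_{n₁}` with `Z ≠ 0` is within
`(Λ_{n₁} + s_max Dt_min (3w_{n₂}/4))/(Dt_min − 2A)` of `klFermiPoint μ K θ_{n₂,ω₂}` (sup norm). [cite: BenfattoGiulianiMastropietro2006, §2.7 (2.69)] -/
theorem symbol_cell (p : Fin 2 → ℝ) (hsq : ∀ i, |p i| ≤ π + z) (hshell : |frameLevel μ K (WithLp.toLp 2 p)| ≤ klScale e₀ n₁)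
    (hZp : Z p ≠ 0) :
    ‖p - klFermiPoint μ K (sectorCenter n₂ (ω₂ : ℕ))‖ ≤
      (klScale e₀ n₁ + B.smax * B.Dtmin * (3 * sectorWidth n₂ / 4)) / (B.Dtmin - 2 * A) := by
  have hΛ := klScale_le_e0 he.le n₁
  obtain ⟨-, hζ₂⟩ := angularFactor_support hZ hZp
  exact frameBand_cell B hA hADt hz.le hz1 (by linarith) (by linarith) (by linarith) n₂ (ω₂ : ℕ) hsq hshell hζ₂

omit [NeZero M] in
/-- **Window**: if `Λβ < π(2M − 3)` then `Λ < |π(1−2M)/β + (2π/β) m|` for all integers `m < 2` and `m ≥ 2M − 2` (`β > 0`):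
the symbol's frequency window sits two steps inside the kept Matsubara frequencies. [folklore] -/
theorem symbol_window {Λ β : ℝ} (hβ : 0 < β) (hM : Λ * β < π * (2 * M - 3)) (m : ℤ) (hm : m < 2 ∨ ((2 * M : ℕ) : ℤ) ≤ m + 2) :
    Λ < |π * (1 - 2 * M) / β + 2 * π / β * (m : ℝ)| := by
  have hπ := Real.pi_pos
  have e : π * (1 - 2 * M) / β + 2 * π / β * (m : ℝ) = π * (2 * (m : ℝ) + 1 - 2 * M) / β := by field_simp; ring
  rw [e, abs_div, abs_of_pos hβ, lt_div_iff₀ hβ, abs_mul, abs_of_pos hπ]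
  refine lt_of_lt_of_le hM (mul_le_mul_of_nonneg_left ?_ hπ.le)
  rcases hm with hm | hm
  · have hm' : (m : ℝ) ≤ 1 := by exact_mod_cast (by omega : m ≤ 1)
    rw [le_abs]; right; linarith
  · have hm' : (2 * (M : ℝ)) - 2 ≤ (m : ℝ) := by
      have : (2 * M : ℤ) - 2 ≤ m := by push_cast at hm ⊢; omega
      exact_mod_cast this
    rw [le_abs]; left; linarith

end Instance

end Summit.HubbardSuperconductivity.HubbardSuperconductivity.Theorems.TorusFourierL2

end
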